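import Literature.NumberTheory.EllipticCurves.IwasawaAlgebraEisensteinTwistedInvariantsReadout
import Literature.NumberTheory.EllipticCurves.ZpExtensionScalarTwistMaps
import HarnessLib

/-!
# The tail readout commutes with the change of level `A_{m,k'} ⊗ M' → A_{m,k} ⊗ M`

Topic `NumberTheory/EllipticCurves` (sequel to `IwasawaAlgebraEisensteinTwistedInvariantsReadout` (the tail readout
`λ_k : A_{m,k} ⊗ M → M`) and `ZpExtensionScalarTwistMaps` (`EisensteinCoeff.reduce`, `eisensteinTwistReduceLinear = reduce ⊗ f`);
cell `pub/bsd-print-x9`, blueprint HOME/p2/S1-DISCRETE-CONTROL §1(d), the level compatibility of the maps `ι_{m,k}`).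
Theorems only; no definition, no named fact, no `sorry`.

* `EisensteinCoeff.tailFormZMod_reduce`: `λ_k(reduce c) = (λ_{k'} c mod p^k)`;
* `nsmul_val_cast_eq`: `(x mod p^k).val • b = x.val • b` on a `p^k`-torsion element `b`;
* **`Twisted.tailReadout_eisensteinTwistReduceLinear`**: `λ_k((reduce ⊗ f) y) = f(λ_{k'} y)` for `f : M' → M` additive,
  `p^{k'} M' = 0`, `p^k M = 0` — the readouts of the levels of Howard's tower `T_𝔮/p^{k} T_𝔮` are compatible with the
  reduction maps (for `E`: `f = (P ↦ p·P) : E[p^{k+1}] → E[p^k]`).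

References: [Howard2004HeegnerKolyvagin] §1.6 (arXiv p. 12), §2.2; [Washington1997] §13.2.  BSD is not proved by any of this.
-/

noncomputable section

open Literature.NumberTheory.EllipticCurves

universe u

namespace Literature.NumberTheory.EllipticCurves

namespace IwasawaAlgebra

variable (p : ℕ) [hp : Fact p.Prime] {m : ℕ} (hm : 1 ≤ m) {k k' : ℕ} (hkk' : k ≤ k')

/-- **`λ_k ∘ reduce = (λ_{k'} mod p^k)`**: the tail forms of the levels `A_{m,k'} ↠ A_{m,k}` are compatible.
[cite: Howard2004HeegnerKolyvagin, §2.1–§2.2 (the map 𝒟_𝔮 → ℚ_p/ℤ_p restricted to p^{-k}S/S)] [cite: Washington1997, §13.2] -/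
theorem EisensteinCoeff.tailFormZMod_reduce (c : EisensteinCoeff p m k') :
    EisensteinCoeff.tailFormZMod p hm k (EisensteinCoeff.reduce p m hkk' c) =
      (ZMod.castHom (pow_dvd_pow p hkk') (ZMod (p ^ k))) (EisensteinCoeff.tailFormZMod p hm k' c) := by
  obtain ⟨f, rfl⟩ := Ideal.Quotient.mk_surjective c
  rw [EisensteinCoeff.reduce_mk, EisensteinCoeff.tailFormZMod_mk, EisensteinCoeff.tailFormZMod_mk, ZMod.castHom_apply,
    PadicInt.cast_toZModPow k k' hkk']

end IwasawaAlgebra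

/-- `(x mod p^k).val • b = x.val • b` for `b` killed by `p^k` (`x ∈ ℤ/p^{k'}`, `k ≤ k'`): the action of `ℤ/p^{k'}` on a
`p^k`-torsion group factors through `ℤ/p^k`. [cite: Washington1997, §13.2] -/
theorem nsmul_val_cast_eq {p : ℕ} [Fact p.Prime] {k k' : ℕ} (hkk' : k ≤ k') {M : Type u} [AddCommGroup M]
    {b : M} (hb : (p ^ k) • b = 0) (x : ZMod (p ^ k')) :
    ((ZMod.castHom (pow_dvd_pow p hkk') (ZMod (p ^ k))) x).val • b = x.val • b := by
  rw [ZMod.castHom_apply, ZMod.cast_eq_val, ZMod.val_natCast]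
  conv_rhs => rw [← Nat.mod_add_div x.val (p ^ k), add_nsmul, mul_nsmul, hb, nsmul_zero, add_zero]

namespace IwasawaAlgebra

variable (p : ℕ) [hp : Fact p.Prime] {m : ℕ} (hm : 1 ≤ m) {k k' : ℕ} (hkk' : k ≤ k')
  {M : Type u} [AddCommGroup M] {M' : Type u} [AddCommGroup M']
  (hM : ∀ a : M, (p ^ k) • a = 0) (hM' : ∀ a : M', (p ^ k') • a = 0)

/-- **The tail readout commutes with the change of level**: `λ_k((reduce ⊗ f) y) = f(λ_{k'}(y))` for an additive
`f : M' → M` (`p^{k'} M' = 0`, `p^k M = 0`).  For `E`, `f = (P ↦ p·P) : E[p^{k+1}] → E[p^k]`: the readouts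
`T_𝔮/p^{k} T_𝔮 → E[p^{k}]` of the levels of Howard's tower are compatible with reduction.
[cite: Howard2004HeegnerKolyvagin, §1.6 (arXiv p. 12) and §2.2] [cite: Washington1997, §13.2] -/
theorem EisensteinCoeff.Twisted.tailReadout_eisensteinTwistReduceLinear (f : M' →ₗ[ℤ] M)
    (y : EisensteinCoeff.Twisted p m k' M') :
    EisensteinCoeff.Twisted.tailReadout p hm k hM (ZpExtension.eisensteinTwistReduceLinear (p := p) hkk' f y) =
      f (EisensteinCoeff.Twisted.tailReadout p hm k' hM' y) := by
  induction y using EisensteinCoeff.Twisted.induction_on with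
  | zero => rw [map_zero, map_zero, map_zero, map_zero]
  | tmul c a =>
    rw [ZpExtension.eisensteinTwistReduceLinear_tmul, EisensteinCoeff.Twisted.tailReadout,
      EisensteinCoeff.Twisted.tailReadout, CoeffExtension.readout_tmul, CoeffExtension.readout_tmul, map_nsmul,
      LinearMap.toAddMonoidHom_coe, LinearMap.toAddMonoidHom_coe, EisensteinCoeff.tailFormZMod_reduce p hm hkk',
      nsmul_val_cast_eq hkk' (hM (f a))]
  | add x y hx hy => rw [map_add, map_add, hx, hy, map_add, map_add]

end IwasawaAlgebra

end Literature.NumberTheory.EllipticCurves
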